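import Summits.CriticalPhenomena.CardyFormulaZ2.Theorems.CardySelfDualSegmentUniformMarginalitySandwichGlue

/-!
# Sandwich glue of line `Sketch`, pointwise-in-the-approximant form
(crux `UniformMarginality`, stmt-CriticalPhenomena-5472)

Skeleton v5 of the lead's line states the transport's research kernel (B₂a′) as LOCAL DOMAIN
CONTINUITY with the mesh threshold chosen AFTER the approximant: for every conformal rectangle `R`,
`t₀ ∈ [0,1]`, `ε > 0` there is a closeness `ε₀ > 0` such that EVERY rectilinear conformal rectangle
`Q` that is `ε₀`-close to `R` in boundary loop and marks admits its own `δ₀(Q) > 0`, `η₀(Q) > 0` with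
`|P_t(Q,δ) − P_t(R,δ)| ≤ ε` for `0 < δ < δ₀`, `|t − t₀| < η₀`. This is WEAKER than the form with
`δ₀, η₀` chosen BEFORE `Q` (skeleton v4, glue `stub_uniformSandwichOfDomainContinuity` of the
`SandwichGlue` file) and equally sufficient, since the glue applies it to the two approximants only.
(Remark, correcting the lead's first reading: lattice-scale rectilinear teeth inside the `ε₀`-collar
do NOT refute the v4 order — the crude event starts within `2δ` of the whole arc `0`, tooth tips and
floor included, so teeth only shorten the domain by `O(ε₀)`; indeed the v4 form follows from the
tightness of ONE nice inner/outer pair by monotonicity. The v5 form is registered because it is the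
weaker hypothesis.)

Proved here: `stub_uniformSandwichOfLocalDomainContinuity` — (B₂a′) and the landed geometry
`stub_mixedApproximants` (p114647) give the local uniform rectilinear sandwiches (B₂a) of skeleton
v3 (nesting by the landed `Pext_mono_of_nested` of the `SandwichGlue` file — `M_t` is carried by
lattice configurations; tightness by the triangle inequality), applying (B₂a′) to the two approximants
only.
-/

noncomputable section

namespace Summit.CriticalPhenomena.CardyFormulaZ2.Cruxes.UniformMarginality.HeatFlow

open MeasureTheory Literature.Probability.Percolation Literature.Probability.LatticeModels
  Literature.Probability.RandomPlanarGeometry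

/-- STUB (glue) of skeleton v5 — **uniform sandwiches from LOCAL domain continuity**: the research
kernel (B₂a′) (crude crossing probabilities of an `ε₀`-close rectilinear marked domain `Q` are
`ε`-close to those of `R` for all meshes below a threshold `δ₀(Q)` and all `t` within `η₀(Q)` of `t₀`)
and the landed geometry `stub_mixedApproximants` give the local uniform rectilinear sandwiches (B₂a):
apply (B₂a′) to the inner and outer approximants `R'`, `R''` and take the lesser thresholds. -/
theorem stub_uniformSandwichOfLocalDomainContinuity :
    (∀ (R : ConformalRectangle) (t₀ : ℝ), t₀ ∈ Set.Icc (0 : ℝ) 1 → ∀ ε : ℝ, 0 < ε →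
      ∃ ε₀ > 0, ∀ Q : ConformalRectangle,
        (∃ S : Finset (ℂ × ℂ), (∀ p ∈ S, p.1.re = p.2.re ∨ p.1.im = p.2.im) ∧
          frontier Q.carrier ⊆ ⋃ p ∈ S, segment ℝ p.1 p.2) →
        (∀ u : ℝ, dist (Q.boundary u) (R.boundary u) ≤ ε₀) → (∀ i : Fin 4, |Q.mark i - R.mark i| ≤ ε₀) →
        ∃ δ₀ > 0, ∃ η₀ > 0, ∀ δ : ℝ, 0 < δ → δ < δ₀ → ∀ t ∈ Set.Icc (0 : ℝ) 1, |t - t₀| < η₀ →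
          |Pext Q δ t - Pext R δ t| ≤ ε) →
    (∀ (R : ConformalRectangle) (t₀ : ℝ), t₀ ∈ Set.Icc (0 : ℝ) 1 → ∀ ε : ℝ, 0 < ε →
      ∃ R' R'' : ConformalRectangle,
        (∃ S : Finset (ℂ × ℂ), (∀ p ∈ S, p.1.re = p.2.re ∨ p.1.im = p.2.im) ∧
          frontier R'.carrier ⊆ ⋃ p ∈ S, segment ℝ p.1 p.2) ∧
        (∃ S : Finset (ℂ × ℂ), (∀ p ∈ S, p.1.re = p.2.re ∨ p.1.im = p.2.im) ∧
          frontier R''.carrier ⊆ ⋃ p ∈ S, segment ℝ p.1 p.2) ∧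
        ∃ δ₀ > 0, ∃ η₀ > 0, ∀ δ : ℝ, 0 < δ → δ < δ₀ → ∀ t ∈ Set.Icc (0 : ℝ) 1, |t - t₀| < η₀ →
          Pext R' δ t ≤ Pext R δ t ∧ Pext R δ t ≤ Pext R'' δ t ∧ Pext R'' δ t - Pext R' δ t ≤ ε) := by
  intro hDC R t₀ ht₀ ε hε
  obtain ⟨ε₀, hε₀, hclose⟩ := hDC R t₀ ht₀ (ε / 2) (by positivity)
  obtain ⟨R', R'', hS', hS'', hb', hm', hb'', hm'', δ₁, hδ₁, hnest⟩ :=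
    stub_mixedApproximants R ε₀ hε₀
  obtain ⟨δ', hδ', η', hη', h'⟩ := hclose R' hS' hb' hm'
  obtain ⟨δ'', hδ'', η'', hη'', h''⟩ := hclose R'' hS'' hb'' hm''
  refine ⟨R', R'', hS', hS'', min δ₁ (min δ' δ''), lt_min hδ₁ (lt_min hδ' hδ''),
    min η' η'', lt_min hη' hη'', ?_⟩
  intro δ hδ hδlt t ht htt₀
  have hδ₁' : δ < δ₁ := hδlt.trans_le (min_le_left _ _)
  have hδ'lt : δ < δ' := hδlt.trans_le ((min_le_right _ _).trans (min_le_left _ _))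
  have hδ''lt : δ < δ'' := hδlt.trans_le ((min_le_right _ _).trans (min_le_right _ _))
  have hη'lt : |t - t₀| < η' := htt₀.trans_le (min_le_left _ _)
  have hη''lt : |t - t₀| < η'' := htt₀.trans_le (min_le_right _ _)
  have hlo : Pext R' δ t ≤ Pext R δ t :=
    Pext_mono_of_nested (fun ω hω hωc => (hnest δ hδ hδ₁' ω hω).1 hωc) t
  have hhi : Pext R δ t ≤ Pext R'' δ t :=
    Pext_mono_of_nested (fun ω hω hωc => (hnest δ hδ hδ₁' ω hω).2 hωc) t
  have h1 := h' δ hδ hδ'lt t ht hη'lt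
  have h2 := h'' δ hδ hδ''lt t ht hη''lt
  refine ⟨hlo, hhi, ?_⟩
  rw [abs_le] at h1 h2
  linarith [h1.1, h2.2]

end Summit.CriticalPhenomena.CardyFormulaZ2.Cruxes.UniformMarginality.HeatFlow

end
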